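import Literature.NumberTheory.Transcendental.DiazZeroLemmaProofs
import Literature.NumberTheory.Transcendental.DiazThm2Smallness
import HarnessLib

/-!
# Diaz 1989, Théorème 2 from Philippon's criterion and the zero lemma

Topic `Literature/NumberTheory/Transcendental` (trunk T-TRANSCEND). Last step of the reduction of
the named fact `Literature.NumberTheory.Transcendental.Diaz1989_thm2` (`DiazMain.lean`; G. Diaz,
J. Number Theory 31 (1989), Théorème 2, p. 2: for `ℚ`-linearly independent `u ∈ ℂⁿ`, `v ∈ ℂᵐ`
with (HT2) and `mn > m + n`, `trdeg_ℚ ℚ(e^{u_hv_k}) ≥ [mn/(m+n)]`) to the two deep tools it rests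
on, both vendored as named facts and both already the inputs of the tree's reduction of
Théorème 1 (`DiazThm1Proofs.lean`):

* `Philippon1986_mainCriterion` (`PhilipponCriterion.lean`; Philippon 1986, Thm 2.11), and
* `Diaz1989_zeroLemma` (`DiazZeroLemma.lean`; Diaz, pp. 11–12), itself PROVED from Philippon's
  zero estimate `Philippon1986_GaGm_P1n` (`Diaz1989_zeroLemma_of_P1n`, `DiazZeroLemmaProofs.lean`).

Main results (everything in this file is proved; no new named facts):

* `Diaz1989_thm2_of_criterion : Philippon1986_mainCriterion → Diaz1989_zeroLemma → Diaz1989_thm2`;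
* `Diaz1989_thm2_of_philippon : Philippon1986_mainCriterion → Philippon1986_GaGm_P1n → Diaz1989_thm2`;
* `Diaz1989_grid_of_criterion2` — LNM 1752, Ch. 14, Thm 2.7 (clause `t`, under (T.H.)) from the
  same two tools (through the tree's `Diaz1989_grid_of_thm2`).

Consequently the open leaves of the Schanuel barrier `diaz1989_largeTrdeg_holds`
(`Literature/Barriers/Schanuel/LargeTranscendenceDegreeProofs.lean`, `largeTranscendenceDegree_of_leaves`:
{criterion, zero estimate, `Diaz1989_thm2`, `Philippon1986_thm_2_12`}) may now be taken to be
{criterion, zero estimate, `Philippon1986_thm_2_12`} (feed `Diaz1989_thm2_of_philippon` to it).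

## The argument

Théorème 2 is Schneider's method on `𝔾ₘⁿ` (no power of `z` in the auxiliary function; cf.
M. Waldschmidt, LNM 1752, Ch. 14, §3): we run the tree's construction `DiazThm1` (§II of the source)
with `D = 1` and the parameters of `DiazThm2Params.lean`, the estimates of
`DiazThm2Smallness.lean` (`Φ = X^{m+n}`, `Ψ = X^{mn} log X`), and:

* §1 — with `D = 1` the polynomials `P_{dλ}`, `P_{dλj}`, `R_{dλμ}`, `Q_{μj} ∈ ℤ[Y_k, Y_hk]` do not
  involve the variables `Y_k` (`aeval_Pj_congr`, `aeval_Qj_congr`: their values at two points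
  with the same `Y_hk`-coordinates agree; for the Taylor coefficients `P_{dλj}` this goes through
  `aeval_taylorCoeff_congr`, evaluation of `(1/j!)DʲP` as a coefficient of `P(θ + Z)`);
* §2 — no common zero in the ball `𝓑_ρ` around `θ = (v_k, e^{u_hv_k})` (`eventually_zeroFree`):
  the hypotheses (10) of the zero lemma in the ball (`ball_hyps`, as in `DiazZeroFreeBall.lean`),
  (11) with `D₀ = 1` (`exists_aeval_Qj_ne_zero_or`, (𝒞7), (𝒞8) of `DiazThm2Params.lean`), and
  (𝒞9) (`eventually_C9`): the zero lemma would give `λ ≠ 0`, `μ ≠ 0` with `|λ| ≲ L²M₁ ≍ X^{2m+n}`,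
  `|μ| ≲ LM₁² ≍ X^{m+2n}`, `|λ.u|·|μ.v| ≲ e^{-ρ/2}`, while (HT2)(a) with exponent `mn/(2m+n)` and
  (HT2)(b) with exponent `mn/(m+2n)` give `|λ.u|, |μ.v| ≥ exp(-CX^{mn}) ≥ exp(-Ψ)` for large `X`
  (both exponents are critical: the room is the factor `log X` of `ρ = 16(n+1)Ψ`);
* §3 — the assembly (as `DiazThm1Proofs.lean`, §II-4-3 of the source): the family
  `𝓕_X = {Q_{μj}}` is small at `θ`, `|Q(θ)| ≤ e^{-c_SΨ}`, has degrees and log-lengths `≤ c_δΦ`, no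
  common zero in `𝓑_ρ` and a member `≠ 0` at `θ`; Philippon's criterion is applied at the point
  `θ'' = (0, …, 0, e^{u_hv_k}) ∈ ℂ^{m+nm}` — by §1 the values at `θ''` and at `θ` agree, a common zero
  `z` near `θ''` would give the common zero `(v_k, z_hk)` near `θ`, and `ℚ(θ'') = ℚ(e^{u_hv_k})` — with
  `σ = δ = c_δΦ`, `R = ρ`, `S = c_SΨ`, `k + 1 = [mn/(m+n)]`: the main inequality reduces to
  `KΦ^{k+1} ≤ Ψ`, true for large `X` since `(m+n)(k+1) ≤ mn` and `Ψ` carries the extra `log X`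
  (`eventually_Phq_pow_le_Psq`). The criterion gives `trdeg ℚ(e^{u_hv_k}) ≥ k + 1`.

## References

* G. Diaz, *Grands degrés de transcendance pour des familles d'exponentielles*, J. Number Theory
  31 (1989), 1–23, Théorème 2, p. 2 (statement); §II, pp. 4–16 (the scheme, printed for Théorème 1).
* P. Philippon, *Critères pour l'indépendance algébrique*, Publ. Math. IHÉS 64 (1986), 5–52,
  Thm 2.11; *Lemmes de zéros dans les groupes algébriques commutatifs*, Bull. SMF 114 (1986).
* M. Waldschmidt, Ch. 14 of Yu. V. Nesterenko, P. Philippon (eds.), *Introduction to Algebraic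
  Independence Theory*, LNM 1752 (2001), Thm 2.7 and §3.
-/

noncomputable section

open Filter Real Finset Literature.NumberTheory.Transcendental.Asymp MvPolynomial
  Literature.NumberTheory.Transcendental.Chudnovsky Literature.NumberTheory.Transcendental.Taylor

namespace Literature.NumberTheory.Transcendental

namespace DiazThm2

open DiazThm1 (a1 a2 one_le_a1 one_le_a2 Var theta theta_inl theta_inr Unk DL ExpIdx Pdl Rfac Q Qj
  Pj IsMinIdx exists_isMinIdx T0 totalDegree_Pdl_le degreeOf_Pdl_inl_le linForm lamMu lamMu_inl
  lamMu_inr exists_coeffs zlog exp_zlog norm_zlog_sub_le Ptilde Ptilde_ne_zero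
  degreeOf_Ptilde_zero_le degreeOf_Ptilde_succ_le eval_Ptilde_eq ZeroLemmaAt exists_zeroLemmaAt
  Delta0 Delta0_pos MeasureA.lower MeasureB.lower half_cube_mul_exp_lt shift_le_mul_scale
  rpow_le_of_le_mul_scale one_le_scale scale_mono scale_add_one_le scale_div_scale varEquiv
  l1_rename_of_injective trdeg_adjoin_congr three_le_X exp_one_le_X)

variable {m n : ℕ}

/-! ### §1. With `D = 1` the polynomials do not involve the variables `Y_k` -/

section Independence

variable {σ : Type*}

/-- The ring map `P ↦ P(θ + Z) ∈ ℂ[Z]`. [folklore] -/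
def shiftAt (θ : σ → ℂ) : MvPolynomial σ ℤ →+* MvPolynomial σ ℂ :=
  eval₂Hom (algebraMap ℤ (MvPolynomial σ ℂ)) fun i => C (θ i) + X i

/-- `map (evaluation at θ) ∘ shift = shiftAt θ`. [folklore] -/
theorem map_comp_shift (θ : σ → ℂ) :
    (MvPolynomial.map (eval₂Hom (algebraMap ℤ ℂ) θ)).comp
      (shift : MvPolynomial σ ℤ →ₐ[ℤ] MvPolynomial σ (MvPolynomial σ ℤ)).toRingHom = shiftAt θ := by
  apply ringHom_ext
  · intro r
    simp [shiftAt]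
  · intro i
    simp [shiftAt]

/-- `(taylorCoeff j P)(θ)` is the coefficient of `Zʲ` in `P(θ + Z)`. [folklore] -/
theorem aeval_taylorCoeff_eq (θ : σ → ℂ) (j : σ →₀ ℕ) (P : MvPolynomial σ ℤ) :
    aeval θ (taylorCoeff j P) = coeff j (shiftAt θ P) := by
  have h := RingHom.congr_fun (map_comp_shift θ) P
  simp only [RingHom.coe_comp, Function.comp_apply, AlgHom.toRingHom_eq_coe,
    AlgHom.coe_toRingHom] at h
  rw [MvPolynomial.aeval_def, taylorCoeff, ← MvPolynomial.coe_eval₂Hom, ← coeff_map, h]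

/-- **Taylor coefficients only see the variables of `P`**: the values of `taylorCoeff j P` at two
points that agree on `P.vars` coincide. [folklore] -/
theorem aeval_taylorCoeff_congr (P : MvPolynomial σ ℤ) {θ₁ θ₂ : σ → ℂ}
    (h : ∀ i ∈ P.vars, θ₁ i = θ₂ i) (j : σ →₀ ℕ) :
    aeval θ₁ (taylorCoeff j P) = aeval θ₂ (taylorCoeff j P) := by
  have key : shiftAt θ₁ P = shiftAt θ₂ P :=
    hom_congr_vars (RingHom.ext_int _ _) (fun i hi _ => by simp [shiftAt, h i hi]) rfl
  rw [aeval_taylorCoeff_eq, aeval_taylorCoeff_eq, key]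

end Independence

variable {L M : ℕ}

/-- With `D = 1`, `P_{dλ}` does not involve `Y_k`. [folklore] -/
theorem inl_notMem_vars_Pdl (p : Unk m n 1 L M → ℤ) (a : DL n 1 L) (k : Fin m) :
    Sum.inl k ∉ (Pdl p a).vars := by
  classical
  intro hk
  obtain ⟨d, hd, hkd⟩ := (mem_vars_iff_mem_support _).mp hk
  have hdeg : degreeOf (Sum.inl k) (Pdl p a) < 1 :=
    lt_of_le_of_lt (degreeOf_Pdl_inl_le p a k) (by norm_num)
  have := (degreeOf_lt_iff one_pos).mp hdeg d hd
  rw [Finsupp.mem_support_iff] at hkd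
  omega

/-- **With `D = 1` the `P_{dλj}` do not involve `Y_k`**: their values at two points with the same
`Y_hk`-coordinates agree. [folklore] -/
theorem aeval_Pj_congr (p : Unk m n 1 L M → ℤ) {θ₁ θ₂ : Var m n → ℂ}
    (h : ∀ q, θ₁ (Sum.inr q) = θ₂ (Sum.inr q)) (a : DL n 1 L) (j : Var m n →₀ ℕ) :
    aeval θ₁ (Pj p a j) = aeval θ₂ (Pj p a j) := by
  unfold Pj
  refine aeval_taylorCoeff_congr (Pdl p a) (fun i hi => ?_) j
  cases i with
  | inl k => exact absurd hi (inl_notMem_vars_Pdl p a k)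
  | inr q => exact h q

/-- With `D = 1`, `R_{dλμ} = ∏ Y_hk^{λ_hμ_k}` does not involve `Y_k`. [folklore] -/
theorem aeval_Rfac_congr {θ₁ θ₂ : Var m n → ℂ} (h : ∀ q, θ₁ (Sum.inr q) = θ₂ (Sum.inr q))
    (a : DL n 1 L) (μ : Fin m → ℕ) : aeval θ₁ (Rfac a μ) = aeval θ₂ (Rfac a μ) := by
  classical
  have ha : (a.1 : ℕ) = 0 := by have := a.1.isLt; omega
  unfold Rfac
  rw [ha, pow_zero, one_mul, aeval_monomial, aeval_monomial, map_one,
    Finsupp.prod_fintype _ _ (fun i => by simp), Finsupp.prod_fintype _ _ (fun i => by simp),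
    Fintype.prod_sum_type, Fintype.prod_sum_type]
  simp only [lamMu_inl, pow_zero, Finset.prod_const_one, one_mul, lamMu_inr, h]

/-- **With `D = 1` the `Q_{μj}` do not involve `Y_k`.** [folklore] -/
theorem aeval_Qj_congr (p : Unk m n 1 L M → ℤ) {θ₁ θ₂ : Var m n → ℂ}
    (h : ∀ q, θ₁ (Sum.inr q) = θ₂ (Sum.inr q)) (μ : Fin m → ℕ) (j : Var m n →₀ ℕ) :
    aeval θ₁ (Qj p μ j) = aeval θ₂ (Qj p μ j) := by
  unfold Qj
  rw [map_sum, map_sum]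
  refine Finset.sum_congr rfl fun a _ => ?_
  rw [map_mul, map_mul, aeval_Pj_congr p h a j, aeval_Rfac_congr h a μ]

/-- With `D = 1`, minimal indices only depend on the `Y_hk`-coordinates. [folklore] -/
theorem isMinIdx_congr (p : Unk m n 1 L M → ℤ) {θ₁ θ₂ : Var m n → ℂ}
    (h : ∀ q, θ₁ (Sum.inr q) = θ₂ (Sum.inr q)) {j : Var m n →₀ ℕ} (hj : IsMinIdx p θ₁ j) :
    IsMinIdx p θ₂ j := by
  obtain ⟨⟨a, ha⟩, hmin⟩ := hj
  refine ⟨⟨a, by rwa [← aeval_Pj_congr p h a j]⟩, fun a' j' hj' => ?_⟩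
  rw [← aeval_Pj_congr p h a' j']
  exact hmin a' j' hj'

/-! ### §2. No common zero of the `Q_{μj}` in the ball `𝓑_ρ` -/

/-! #### Sizes of the bounds (12) for the chosen parameters -/

/-- `L - 1 ≤ a₁ Xᵐ` (`X ≥ 1`). [folklore] -/
theorem L_sub_one_le {X : ℝ} (hX : 1 ≤ X) : ((Lq m n X - 1 : ℕ) : ℝ) ≤ a1 m n * scale m 0 X :=
  le_trans (by exact_mod_cast Nat.sub_le _ _) (L_le hX)

/-- `(M₁ - 1)/(n+1) ≤ a₂ Xⁿ` (`X ≥ 1`). [folklore] -/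
theorem M1_sub_one_div_le {X : ℝ} (hX : 1 ≤ X) :
    ((M1q m n X - 1 : ℕ) : ℝ) / (n + 1) ≤ a2 m n * scale n 0 X := by
  have h1 : ((M1q m n X - 1 : ℕ) : ℝ) ≤ M1q m n X := by exact_mod_cast Nat.sub_le _ _
  have h3 : (M1q m n X : ℝ) ≤ a2 m n * scale n 0 X := by
    rw [M1_eq]; exact mul_le_mul_of_nonneg_left (M_le hX) (Nat.cast_nonneg _)
  have hn1 : (1 : ℝ) ≤ n + 1 := by
    have : (0 : ℝ) ≤ n := Nat.cast_nonneg n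
    linarith
  have h0 : 0 ≤ ((M1q m n X - 1 : ℕ) : ℝ) := Nat.cast_nonneg _
  calc ((M1q m n X - 1 : ℕ) : ℝ) / (n + 1) ≤ ((M1q m n X - 1 : ℕ) : ℝ) := div_le_self h0 hn1
    _ ≤ _ := h1.trans h3

/-- The scale of the bound for `|λ|` in (12): `(L-1)²(M₁-1)/(n+1) ≤ a₁²a₂ X^{2m+n}`.
[cite: Diaz1989, §II-3-4 (12) p. 12] -/
theorem bound_lam_le {X : ℝ} (hX : 1 < X) :
    ((Lq m n X - 1 : ℕ) : ℝ) ^ 2 * (((M1q m n X - 1 : ℕ) : ℝ) / (n + 1)) ≤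
      (a1 m n : ℝ) ^ 2 * a2 m n * scale (2 * m + n) 0 X := by
  have hL := L_sub_one_le (m := m) (n := n) hX.le
  have hM := M1_sub_one_div_le (m := m) (n := n) hX.le
  have hs1 := scale_nonneg (a := m) (b := 0) hX.le
  have hs2 := scale_nonneg (a := n) (b := 0) hX.le
  calc ((Lq m n X - 1 : ℕ) : ℝ) ^ 2 * (((M1q m n X - 1 : ℕ) : ℝ) / (n + 1))
      ≤ (a1 m n * scale m 0 X) ^ 2 * (a2 m n * scale n 0 X) :=
        mul_le_mul (pow_le_pow_left₀ (Nat.cast_nonneg _) hL 2) hM (by positivity) (by positivity)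
    _ = (a1 m n : ℝ) ^ 2 * a2 m n * (scale m 0 X ^ (2 : ℕ) * scale n 0 X) := by ring
    _ = _ := by
        rw [scale_pow hX.le, scale_mul_scale hX]
        congr 1
        push_cast
        ring_nf

/-- The scale of the bound for `|μ|` in (12): `(L-1)((M₁-1)/(n+1))² ≤ a₁a₂² X^{m+2n}`.
[cite: Diaz1989, §II-3-4 (12) p. 12] -/
theorem bound_mu_le {X : ℝ} (hX : 1 < X) :
    ((Lq m n X - 1 : ℕ) : ℝ) * (((M1q m n X - 1 : ℕ) : ℝ) / (n + 1)) ^ 2 ≤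
      (a1 m n : ℝ) * (a2 m n) ^ 2 * scale (m + 2 * n) 0 X := by
  have hL := L_sub_one_le (m := m) (n := n) hX.le
  have hM := M1_sub_one_div_le (m := m) (n := n) hX.le
  have hs1 := scale_nonneg (a := m) (b := 0) hX.le
  have hs2 := scale_nonneg (a := n) (b := 0) hX.le
  have h0 : 0 ≤ ((M1q m n X - 1 : ℕ) : ℝ) / (n + 1) := by positivity
  calc ((Lq m n X - 1 : ℕ) : ℝ) * (((M1q m n X - 1 : ℕ) : ℝ) / (n + 1)) ^ 2
      ≤ (a1 m n * scale m 0 X) * (a2 m n * scale n 0 X) ^ 2 :=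
        mul_le_mul hL (pow_le_pow_left₀ h0 hM 2) (by positivity) (by positivity)
    _ = (a1 m n : ℝ) * (a2 m n) ^ 2 * (scale m 0 X * scale n 0 X ^ (2 : ℕ)) := by ring
    _ = _ := by
        rw [scale_pow hX.le, scale_mul_scale hX]
        congr 1
        push_cast
        ring_nf

/-- The scale of the bound for `|λ.u|·|μ.v|` in (12): `(L-1)²((M₁-1)/(n+1))² ≤ a₁²a₂² X^{2m+2n}`.
[cite: Diaz1989, §II-3-4 (12) p. 12] -/
theorem bound_prod_le {X : ℝ} (hX : 1 < X) :
    ((Lq m n X - 1 : ℕ) : ℝ) ^ 2 * (((M1q m n X - 1 : ℕ) : ℝ) / (n + 1)) ^ 2 ≤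
      (a1 m n : ℝ) ^ 2 * (a2 m n) ^ 2 * scale (2 * m + 2 * n) 0 X := by
  have hL := L_sub_one_le (m := m) (n := n) hX.le
  have hM := M1_sub_one_div_le (m := m) (n := n) hX.le
  have hs1 := scale_nonneg (a := m) (b := 0) hX.le
  have hs2 := scale_nonneg (a := n) (b := 0) hX.le
  have h0 : 0 ≤ ((M1q m n X - 1 : ℕ) : ℝ) / (n + 1) := by positivity
  calc ((Lq m n X - 1 : ℕ) : ℝ) ^ 2 * (((M1q m n X - 1 : ℕ) : ℝ) / (n + 1)) ^ 2
      ≤ (a1 m n * scale m 0 X) ^ 2 * (a2 m n * scale n 0 X) ^ 2 :=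
        mul_le_mul (pow_le_pow_left₀ (Nat.cast_nonneg _) hL 2) (pow_le_pow_left₀ h0 hM 2)
          (by positivity) (by positivity)
    _ = (a1 m n : ℝ) ^ 2 * (a2 m n) ^ 2 * (scale m 0 X ^ (2 : ℕ) * scale n 0 X ^ (2 : ℕ)) := by
        ring
    _ = _ := by
        rw [scale_pow hX.le, scale_pow hX.le, scale_mul_scale hX]
        congr 1
        push_cast
        ring_nf

/-! #### (𝒞9): the technical hypothesis (HT2) excludes the small pair `(λ, μ)` of the zero lemma -/

/-- Eventual domination `C X^a ≤ X^{a'} log X` whenever `a ≤ a'` (strict: powers of `X`; equality: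
the factor `log X`). [folklore] -/
theorem eventually_mul_scale_zero_le {a a' : ℝ} (h : a ≤ a') (C : ℝ) :
    ∀ᶠ X in atTop, C * scale a 0 X ≤ scale a' 1 X := by
  rcases h.lt_or_eq with hlt | heq
  · exact eventually_mul_scale_le_of_lt hlt 0 1 C
  · rw [heq]
    exact eventually_mul_scale_le_of_lt_right a' zero_lt_one C

/-- **(𝒞9) at a fixed `X`** (pointwise form of `eventually_C9`): if the three dominations
`(K_a + X_a + 1)^{ηa} X^{(2m+n)ηa} ≤ Ψ`, `(K_b + X_b + 1)^{ηb} X^{(m+2n)ηb} ≤ Ψ`,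
`2K_p X^{2m+2n} ≤ Ψ³` (`Ψ = X^{mn} log X`) hold at `X ≥ e`, then no nonzero `(λ, μ)` satisfies (12)
with `V = ρ/2`. [cite: Diaz1989, §II-3-4 (𝒞9) p. 14] -/
theorem C9_at {u : Fin n → ℂ} {v : Fin m → ℂ} {ηa ηb : ℝ} (hηa : 0 ≤ ηa) (hηb : 0 ≤ ηb)
    {c Δ Xa Xb : ℝ} (hc : 0 < c) (hΔ : 0 < Δ) (hXa : 0 < Xa) (hXb : 0 < Xb)
    (hAl : ∀ lam : Fin n → ℤ, lam ≠ 0 → ∀ B : ℝ, 0 ≤ B → (∀ i, (|lam i| : ℝ) ≤ B) →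
      Real.exp (-((B + Xa + 1) ^ ηa)) ≤ ‖∑ i, (lam i : ℂ) * u i‖)
    (hBl : ∀ mu : Fin m → ℤ, mu ≠ 0 → ∀ B : ℝ, 0 ≤ B → (∀ k, (|mu k| : ℝ) ≤ B) →
      Real.exp (-((B + Xb + 1) ^ ηb)) ≤ ‖∑ k, (mu k : ℂ) * v k‖)
    {X : ℝ} (hXe : Real.exp 1 ≤ X) (hX1 : 1 < X)
    (hA1 : (c * Δ * ((a1 m n : ℝ) ^ 2 * a2 m n) + Xa + 1) ^ ηa *
        scale ((2 * m + n) * ηa) (0 * ηa) X ≤ scale (m * n) 1 X)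
    (hB1 : (c * Δ * ((a1 m n : ℝ) * (a2 m n) ^ 2) + Xb + 1) ^ ηb *
        scale ((m + 2 * n) * ηb) (0 * ηb) X ≤ scale (m * n) 1 X)
    (hP1 : 2 * (c * Δ * ((a1 m n : ℝ) ^ 2 * (a2 m n) ^ 2)) * scale (2 * m + 2 * n) 0 X ≤
      scale (3 * (m * n)) 3 X)
    (lam : Fin n → ℤ) (mu : Fin m → ℤ) (hlam : lam ≠ 0) (hmu : mu ≠ 0)
    (hlamB : ∀ i, (|lam i| : ℝ) ≤
      c * Δ * ((Lq m n X - 1 : ℕ) : ℝ) ^ 2 * (((M1q m n X - 1 : ℕ) : ℝ) / (n + 1)))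
    (hmuB : ∀ k, (|mu k| : ℝ) ≤
      c * Δ * ((Lq m n X - 1 : ℕ) : ℝ) * (((M1q m n X - 1 : ℕ) : ℝ) / (n + 1)) ^ 2) :
    c * Δ * ((Lq m n X - 1 : ℕ) : ℝ) ^ 2 * (((M1q m n X - 1 : ℕ) : ℝ) / (n + 1)) ^ 2 *
        Real.exp (-(rhoq m n X / 2)) <
      ‖∑ i, (lam i : ℂ) * u i‖ * ‖∑ k, (mu k : ℂ) * v k‖ := by
  have hcΔ : 0 ≤ c * Δ := by positivity
  have hn0 : (0 : ℝ) ≤ n := Nat.cast_nonneg n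
  have hm0 : (0 : ℝ) ≤ m := Nat.cast_nonneg m
  have hP1' : 1 ≤ scale (m * n) 1 X := one_le_scale (by positivity) zero_le_one hXe
  have hsA1 : 1 ≤ scale (2 * m + n) 0 X := one_le_scale (by positivity) le_rfl hXe
  have hsB1 : 1 ≤ scale (m + 2 * n) 0 X := one_le_scale (by positivity) le_rfl hXe
  -- the three bounds of (12) as multiples of scales
  have hbl : c * Δ * ((Lq m n X - 1 : ℕ) : ℝ) ^ 2 * (((M1q m n X - 1 : ℕ) : ℝ) / (n + 1)) ≤
      c * Δ * ((a1 m n : ℝ) ^ 2 * a2 m n) * scale (2 * m + n) 0 X := by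
    have := mul_le_mul_of_nonneg_left (bound_lam_le (m := m) (n := n) hX1) hcΔ
    calc _ = c * Δ * (((Lq m n X - 1 : ℕ) : ℝ) ^ 2 * (((M1q m n X - 1 : ℕ) : ℝ) / (n + 1))) := by
          ring
      _ ≤ _ := this
      _ = _ := by ring
  have hbm : c * Δ * ((Lq m n X - 1 : ℕ) : ℝ) * (((M1q m n X - 1 : ℕ) : ℝ) / (n + 1)) ^ 2 ≤
      c * Δ * ((a1 m n : ℝ) * (a2 m n) ^ 2) * scale (m + 2 * n) 0 X := by
    have := mul_le_mul_of_nonneg_left (bound_mu_le (m := m) (n := n) hX1) hcΔ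
    calc _ = c * Δ * (((Lq m n X - 1 : ℕ) : ℝ) * (((M1q m n X - 1 : ℕ) : ℝ) / (n + 1)) ^ 2) := by
          ring
      _ ≤ _ := this
      _ = _ := by ring
  have hbp : c * Δ * ((Lq m n X - 1 : ℕ) : ℝ) ^ 2 * (((M1q m n X - 1 : ℕ) : ℝ) / (n + 1)) ^ 2 ≤
      c * Δ * ((a1 m n : ℝ) ^ 2 * (a2 m n) ^ 2) * scale (2 * m + 2 * n) 0 X := by
    have := mul_le_mul_of_nonneg_left (bound_prod_le (m := m) (n := n) hX1) hcΔ
    calc _ = c * Δ * (((Lq m n X - 1 : ℕ) : ℝ) ^ 2 * (((M1q m n X - 1 : ℕ) : ℝ) / (n + 1)) ^ 2) := by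
          ring
      _ ≤ _ := this
      _ = _ := by ring
  -- lower bound for `|λ.u|`
  have hTa : (c * Δ * ((Lq m n X - 1 : ℕ) : ℝ) ^ 2 * (((M1q m n X - 1 : ℕ) : ℝ) / (n + 1)) +
      Xa + 1) ^ ηa ≤ scale (m * n) 1 X := by
    have hle := shift_le_mul_scale hbl hsA1 (by linarith : 0 ≤ Xa + 1)
    exact (rpow_le_of_le_mul_scale hX1.le (by positivity) (by positivity) hηa hle).trans hA1
  have hLu : Real.exp (-scale (m * n) 1 X) ≤ ‖∑ i, (lam i : ℂ) * u i‖ :=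
    le_trans (Real.exp_le_exp.mpr (neg_le_neg hTa)) (hAl lam hlam _ (by positivity) hlamB)
  -- lower bound for `|μ.v|`
  have hTb : (c * Δ * ((Lq m n X - 1 : ℕ) : ℝ) * (((M1q m n X - 1 : ℕ) : ℝ) / (n + 1)) ^ 2 +
      Xb + 1) ^ ηb ≤ scale (m * n) 1 X := by
    have hle := shift_le_mul_scale hbm hsB1 (by linarith : 0 ≤ Xb + 1)
    exact (rpow_le_of_le_mul_scale hX1.le (by positivity) (by positivity) hηb hle).trans hB1
  have hLv : Real.exp (-scale (m * n) 1 X) ≤ ‖∑ k, (mu k : ℂ) * v k‖ :=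
    le_trans (Real.exp_le_exp.mpr (neg_le_neg hTb)) (hBl mu hmu _ (by positivity) hmuB)
  -- the product of the lower bounds beats the upper bound (12)
  have hprod : Real.exp (-(2 * scale (m * n) 1 X)) ≤
      ‖∑ i, (lam i : ℂ) * u i‖ * ‖∑ k, (mu k : ℂ) * v k‖ := by
    calc Real.exp (-(2 * scale (m * n) 1 X))
        = Real.exp (-scale (m * n) 1 X) * Real.exp (-scale (m * n) 1 X) := by
          rw [← Real.exp_add]; ring_nf
      _ ≤ _ := mul_le_mul hLu hLv (Real.exp_pos _).le (norm_nonneg _)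
  have h3 : scale (3 * (m * n)) 3 X = scale (m * n) 1 X ^ 3 := by
    rw [scale_pow hX1.le]; ring_nf
  have hsP3 : c * Δ * ((a1 m n : ℝ) ^ 2 * (a2 m n) ^ 2) * scale (2 * m + 2 * n) 0 X ≤
        scale (m * n) 1 X ^ 3 / 2 := by
    rw [h3] at hP1; linarith
  have hρ : rhoq m n X = 16 * (n + 1) * scale (m * n) 1 X := rfl
  calc c * Δ * ((Lq m n X - 1 : ℕ) : ℝ) ^ 2 * (((M1q m n X - 1 : ℕ) : ℝ) / (n + 1)) ^ 2 *
        Real.exp (-(rhoq m n X / 2))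
      ≤ scale (m * n) 1 X ^ 3 / 2 * Real.exp (-(16 * (n + 1) * scale (m * n) 1 X / 2)) := by
        rw [hρ]
        exact mul_le_mul_of_nonneg_right (hbp.trans hsP3) (Real.exp_pos _).le
    _ < Real.exp (-(2 * scale (m * n) 1 X)) := half_cube_mul_exp_lt hP1' n
    _ ≤ _ := hprod

/-- **(𝒞9) eventually**: under (HT2)(a) for `u` with an exponent `ηa ≥ 0` such that
`(2m+n)ηa ≤ mn`, and (HT2)(b) for `v` with an exponent `ηb ≥ 0` such that `(m+2n)ηb ≤ mn` (Diaz's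
`ηa = mn/(2m+n)`, `ηb = mn/(m+2n)` qualify, both sharply: the margin is the factor `log X` of `Ψ`),
for all large `X` no nonzero pair `(λ, μ)` satisfies the conclusion (12) of the zero lemma taken
with `D₁ = L-1`, `S = M₁-1`, `V = ρ/2` and fixed `c, Δ > 0`.
[cite: Diaz1989, §II-3-4 (𝒞9) p. 14] -/
theorem eventually_C9 (hmn : m + n < m * n) {u : Fin n → ℂ} {v : Fin m → ℂ} {ηa ηb : ℝ}
    (hA : Diaz1989.MeasureA u ηa) (hB : Diaz1989.MeasureB v ηb)
    (hηa : 0 ≤ ηa) (hηa' : (2 * (m : ℝ) + n) * ηa ≤ m * n)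
    (hηb : 0 ≤ ηb) (hηb' : ((m : ℝ) + 2 * n) * ηb ≤ m * n) {c Δ : ℝ} (hc : 0 < c) (hΔ : 0 < Δ) :
    ∀ᶠ X in atTop, ∀ (lam : Fin n → ℤ) (mu : Fin m → ℤ), lam ≠ 0 → mu ≠ 0 →
      (∀ i, (|lam i| : ℝ) ≤
        c * Δ * ((Lq m n X - 1 : ℕ) : ℝ) ^ 2 * (((M1q m n X - 1 : ℕ) : ℝ) / (n + 1))) →
      (∀ k, (|mu k| : ℝ) ≤
        c * Δ * ((Lq m n X - 1 : ℕ) : ℝ) * (((M1q m n X - 1 : ℕ) : ℝ) / (n + 1)) ^ 2) →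
      c * Δ * ((Lq m n X - 1 : ℕ) : ℝ) ^ 2 * (((M1q m n X - 1 : ℕ) : ℝ) / (n + 1)) ^ 2 *
          Real.exp (-(rhoq m n X / 2)) <
        ‖∑ i, (lam i : ℂ) * u i‖ * ‖∑ k, (mu k : ℂ) * v k‖ := by
  obtain ⟨Xa, hXa, hAl⟩ := MeasureA.lower hA
  obtain ⟨Xb, hXb, hBl⟩ := MeasureB.lower hB
  have hlt3 : 2 * (m : ℝ) + 2 * n < 3 * (m * n) := by
    have h1 : ((m + n : ℕ) : ℝ) < ((m * n : ℕ) : ℝ) := by exact_mod_cast hmn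
    push_cast at h1
    have h2 : (0 : ℝ) ≤ (m : ℝ) * n := by positivity
    linarith
  have hA' := eventually_mul_scale_zero_le hηa' ((c * Δ * ((a1 m n : ℝ) ^ 2 * a2 m n) + Xa + 1) ^ ηa)
  have hB' := eventually_mul_scale_zero_le hηb' ((c * Δ * ((a1 m n : ℝ) * (a2 m n) ^ 2) + Xb + 1) ^ ηb)
  filter_upwards [hA', hB', eventually_mul_scale_le_of_lt hlt3 0 3
      (2 * (c * Δ * ((a1 m n : ℝ) ^ 2 * (a2 m n) ^ 2))),
    eventually_ge_atTop (Real.exp 1), eventually_gt_atTop (1 : ℝ)]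
    with X hA1 hB1 hP1 hXe hX1 lam mu hlam hmu hlamB hmuB
  refine C9_at hηa hηb hc hΔ hXa hXb hAl hBl hXe hX1 ?_ ?_ hP1 lam mu hlam hmu hlamB hmuB
  · simpa only [zero_mul] using hA1
  · simpa only [zero_mul] using hB1

/-! #### The hypotheses (10) of the zero lemma in the ball `𝓑_ρ` -/

/-- **The hypotheses (10) hold in the ball of radius `e^{-ρ}` around `θ` with `V = ρ/2`,
`Δ = Δ₀`**, as soon as `ρ ≥ 4(∑_{h,k}|e^{-u_hv_k}| + m + 1)` (the statement of
`DiazThm1.ball_hyps`, for an arbitrary radius parameter `ρ`; same proof).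
[cite: Diaz1989, §II-3-4 (10) p. 12 and p. 14] -/
theorem ball_hyps (hn : 1 ≤ n) (u : Fin n → ℂ) (v : Fin m → ℂ) {ρ : ℝ}
    (hρ : 4 * ((∑ h, ∑ k, ‖Complex.exp (-(u h * v k))‖) + m + 1) ≤ ρ)
    {θ' : Var m n → ℂ} (hθ' : ∀ i, ‖theta u v i - θ' i‖ ≤ Real.exp (-ρ)) :
    (∀ h k, θ' (Sum.inr (h, k)) ≠ 0) ∧
    (∑ h, ∑ k, ‖zlog u v θ' h k - u h * v k‖) < Real.exp (-(ρ / 2)) ∧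
    (∑ k, ‖θ' (Sum.inl k) - v k‖) < Real.exp (-(ρ / 2)) ∧
    (∑ h, ∑ k, ‖zlog u v θ' h k‖) ≤ Delta0 u v ∧
    Real.pi * ‖u ⟨0, hn⟩‖ ≤ Delta0 u v ∧ Real.pi ≤ Delta0 u v := by
  set E : ℝ := ∑ h, ∑ k, ‖Complex.exp (-(u h * v k))‖ with hEdef
  set ε : ℝ := Real.exp (-ρ) with hεdef
  have hE0 : 0 ≤ E := Finset.sum_nonneg fun h _ => Finset.sum_nonneg fun k _ => norm_nonneg _
  have hm0 : (0 : ℝ) ≤ m := Nat.cast_nonneg m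
  have hε0 : 0 < ε := Real.exp_pos _
  have hεE : ε * E ≤ 1 / 4 := by
    have h1 : ρ + 1 ≤ Real.exp ρ := Real.add_one_le_exp ρ
    have h2 : ε * Real.exp ρ = 1 := by rw [hεdef, ← Real.exp_add]; simp
    have h3 : ε * (ρ + 1) ≤ ε * Real.exp ρ := mul_le_mul_of_nonneg_left h1 hε0.le
    rw [h2] at h3
    nlinarith
  have hexp : Real.exp (-(ρ / 2)) = Real.exp (ρ / 2) * ε := by
    rw [hεdef, ← Real.exp_add]; ring_nf
  have hhalf : 2 * (E + m + 1) < Real.exp (ρ / 2) := by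
    have := Real.add_one_le_exp (ρ / 2); linarith
  have hdist : ∀ h k, ‖θ' (Sum.inr (h, k)) - Complex.exp (u h * v k)‖ ≤ ε := fun h k => by
    rw [norm_sub_rev]; simpa using hθ' (Sum.inr (h, k))
  have ht : ∀ h k, ‖θ' (Sum.inr (h, k)) - Complex.exp (u h * v k)‖ *
      ‖Complex.exp (-(u h * v k))‖ ≤ ε * ‖Complex.exp (-(u h * v k))‖ := fun h k =>
    mul_le_mul_of_nonneg_right (hdist h k) (norm_nonneg _)
  have hle_E : ∀ h k, ‖Complex.exp (-(u h * v k))‖ ≤ E := fun h k => by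
    rw [hEdef]
    refine le_trans ?_ (Finset.single_le_sum (f := fun h => ∑ k, ‖Complex.exp (-(u h * v k))‖)
      (fun h _ => Finset.sum_nonneg fun k _ => norm_nonneg _) (Finset.mem_univ h))
    exact Finset.single_le_sum (f := fun k => ‖Complex.exp (-(u h * v k))‖)
      (fun k _ => norm_nonneg _) (Finset.mem_univ k)
  have ht4 : ∀ h k, ‖θ' (Sum.inr (h, k)) - Complex.exp (u h * v k)‖ *
      ‖Complex.exp (-(u h * v k))‖ ≤ 1 / 4 := fun h k =>
    (ht h k).trans ((mul_le_mul_of_nonneg_left (hle_E h k) hε0.le).trans hεE)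
  have hne : ∀ h k, θ' (Sum.inr (h, k)) ≠ 0 := by
    intro h k h0
    have h1 := ht4 h k
    rw [h0, zero_sub, norm_neg, ← norm_mul, ← Complex.exp_add, add_neg_cancel, Complex.exp_zero,
      norm_one] at h1
    norm_num at h1
  have hz : ∀ h k, ‖zlog u v θ' h k - u h * v k‖ ≤
      3 / 2 * (ε * ‖Complex.exp (-(u h * v k))‖) := fun h k =>
    (norm_zlog_sub_le u v h k ((ht4 h k).trans (by norm_num))).trans
      (mul_le_mul_of_nonneg_left (ht h k) (by norm_num))
  refine ⟨hne, ?_, ?_, ?_, ?_, ?_⟩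
  · calc (∑ h, ∑ k, ‖zlog u v θ' h k - u h * v k‖)
        ≤ ∑ h, ∑ k, 3 / 2 * (ε * ‖Complex.exp (-(u h * v k))‖) :=
          Finset.sum_le_sum fun h _ => Finset.sum_le_sum fun k _ => hz h k
      _ = 3 / 2 * E * ε := by
          rw [hEdef]; simp only [← Finset.mul_sum]; ring
      _ < Real.exp (ρ / 2) * ε := mul_lt_mul_of_pos_right (by linarith) hε0
      _ = Real.exp (-(ρ / 2)) := hexp.symm
  · calc (∑ k, ‖θ' (Sum.inl k) - v k‖) ≤ ∑ _k : Fin m, ε :=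
          Finset.sum_le_sum fun k _ => by
            rw [norm_sub_rev]; simpa using hθ' (Sum.inl k)
      _ = m * ε := by simp
      _ < Real.exp (ρ / 2) * ε := mul_lt_mul_of_pos_right (by linarith) hε0
      _ = Real.exp (-(ρ / 2)) := hexp.symm
  · have hz1 : ∀ h k, ‖zlog u v θ' h k‖ ≤ ‖u h * v k‖ + 1 := fun h k => by
      have h1 : ‖zlog u v θ' h k‖ ≤ ‖u h * v k‖ + ‖zlog u v θ' h k - u h * v k‖ := by
        have := norm_add_le (u h * v k) (zlog u v θ' h k - u h * v k)
        rwa [add_sub_cancel] at this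
      have h2 : ‖zlog u v θ' h k - u h * v k‖ ≤ 1 := by
        refine (norm_zlog_sub_le u v h k ((ht4 h k).trans (by norm_num))).trans ?_
        linarith [ht4 h k]
      linarith
    calc (∑ h, ∑ k, ‖zlog u v θ' h k‖) ≤ ∑ h, ∑ k, (‖u h * v k‖ + 1) :=
          Finset.sum_le_sum fun h _ => Finset.sum_le_sum fun k _ => hz1 h k
      _ ≤ Delta0 u v := by
          unfold Delta0
          have : 0 ≤ Real.pi * ∑ h, ‖u h‖ :=
            mul_nonneg Real.pi_pos.le (Finset.sum_nonneg fun h _ => norm_nonneg _)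
          linarith [Real.pi_pos]
  · unfold Delta0
    have h1 : ‖u ⟨0, hn⟩‖ ≤ ∑ h, ‖u h‖ :=
      Finset.single_le_sum (f := fun h => ‖u h‖) (fun h _ => norm_nonneg _) (Finset.mem_univ _)
    have h2 : 0 ≤ ∑ h, ∑ k, (‖u h * v k‖ + 1) :=
      Finset.sum_nonneg fun h _ => Finset.sum_nonneg fun k _ => by positivity
    have h3 := mul_le_mul_of_nonneg_left h1 Real.pi_pos.le
    linarith [Real.pi_pos]
  · unfold Delta0
    have h2 : 0 ≤ ∑ h, ∑ k, (‖u h * v k‖ + 1) :=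
      Finset.sum_nonneg fun h _ => Finset.sum_nonneg fun k _ => by positivity
    have : 0 ≤ Real.pi * ∑ h, ‖u h‖ :=
      mul_nonneg Real.pi_pos.le (Finset.sum_nonneg fun h _ => norm_nonneg _)
    linarith

/-! #### The zero lemma applied with `D₀ = 1` -/

/-- **§II-3-4, the alternative, for `D = 1`.** Let `j` be a minimal index at `θ̃` (unknowns with
`D = 1`), all `θ̃_hk ≠ 0`, and let `V, Δ` satisfy the hypotheses (10) of the zero lemma for
`θ_k = θ̃_k`, `z_hk = zlog u v θ̃ h k`; let `L ≥ 2`, `M₁ ≥ 2` satisfy (11) with `S = M₁ - 1`,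
`D₀ = 1` (`deg_{W₀} P̃ = 0 ≤ 1`), `D₁ = L - 1`. Then either some `Q_{μj}(θ̃) ≠ 0` with `|μ| < M₁`, or
there is a pair `(λ, μ) ≠ (0, 0)` as in (12). [cite: Diaz1989, §II-3-4 pp. 12–14] -/
theorem exists_aeval_Qj_ne_zero_or (hn : 1 ≤ n) (hm : 2 ≤ m) {c : ℝ} (hZc : ZeroLemmaAt n hn c)
    (u : Fin n → ℂ) (v : Fin m → ℂ) (hu : LinearIndependent ℚ u) (hv : LinearIndependent ℚ v)
    (p : Unk m n 1 L M → ℤ) {j : Var m n →₀ ℕ} {θ' : Var m n → ℂ} (hj : IsMinIdx p θ' j)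
    (hne : ∀ h k, θ' (Sum.inr (h, k)) ≠ 0) {V Δ : ℝ} (hV : 0 < V) (hΔ : 0 < Δ)
    (h10a : (∑ h, ∑ k, ‖zlog u v θ' h k - u h * v k‖) < Real.exp (-V))
    (h10b : (∑ k, ‖θ' (Sum.inl k) - v k‖) < Real.exp (-V))
    (h10c : (∑ h, ∑ k, ‖zlog u v θ' h k‖) ≤ Δ) (h10d : Real.pi * ‖u ⟨0, hn⟩‖ ≤ Δ)
    (h10e : Real.pi ≤ Δ) (hL : 2 ≤ L) {M₁ : ℕ} (hM₁ : 2 ≤ M₁)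
    (h11a : ((n + 1).factorial : ℝ) * 1 * ((L - 1 : ℕ) : ℝ) ^ n <
      (((M₁ - 1 : ℕ) : ℝ) / (n + 1)) ^ m)
    (h11b : (n + 1 : ℝ) * ((L - 1 : ℕ) : ℝ) < (((M₁ - 1 : ℕ) : ℝ) / (n + 1)) ^ (m - 1)) :
    (∃ μ : Fin m → ℕ, (∀ k, μ k < M₁) ∧ aeval θ' (Qj p μ j) ≠ 0) ∨
    ∃ (lam : Fin n → ℤ) (mu : Fin m → ℤ), lam ≠ 0 ∧ mu ≠ 0 ∧
      (∀ i, (|lam i| : ℝ) ≤ c * Δ * ((L - 1 : ℕ) : ℝ) ^ 2 * (((M₁ - 1 : ℕ) : ℝ) / (n + 1))) ∧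
      (∀ k, (|mu k| : ℝ) ≤ c * Δ * ((L - 1 : ℕ) : ℝ) * (((M₁ - 1 : ℕ) : ℝ) / (n + 1)) ^ 2) ∧
      ‖∑ i, (lam i : ℂ) * u i‖ * ‖∑ k, (mu k : ℂ) * v k‖ ≤
        c * Δ * ((L - 1 : ℕ) : ℝ) ^ 2 * (((M₁ - 1 : ℕ) : ℝ) / (n + 1)) ^ 2 * Real.exp (-V) := by
  classical
  by_cases hex : ∃ μ : Fin m → ℕ, (∀ k, μ k < M₁) ∧ aeval θ' (Qj p μ j) ≠ 0
  · exact Or.inl hex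
  right
  push Not at hex
  have hS : (0 : ℝ) < ((M₁ - 1 : ℕ) : ℝ) := by
    have : (1 : ℕ) ≤ M₁ - 1 := by omega
    exact_mod_cast this
  have hD₁ : (0 : ℝ) < ((L - 1 : ℕ) : ℝ) := by
    have : (1 : ℕ) ≤ L - 1 := by omega
    exact_mod_cast this
  refine hZc m hm _ V 1 _ Δ hS hV one_pos hD₁ hΔ u v hu hv (fun k => θ' (Sum.inl k)) (zlog u v θ')
    h10a h10b h10c h10d h10e (Ptilde p j θ') (Ptilde_ne_zero hj) ?_ ?_ ?_ le_rfl ?_ h11a h11b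
  · have h0 := degreeOf_Ptilde_zero_le p j θ'
    have : ((degreeOf 0 (Ptilde p j θ') : ℕ) : ℝ) ≤ ((1 - 1 : ℕ) : ℝ) := by exact_mod_cast h0
    refine this.trans ?_
    norm_num
  · intro h
    exact_mod_cast degreeOf_Ptilde_succ_le p j θ' h
  · intro μ hμ
    have hμ' : ∀ k, μ k < M₁ := fun k => by
      have := hμ k
      have h1 : ((M₁ - 1 : ℕ) : ℝ) + 1 = M₁ := by
        have : ((M₁ - 1 : ℕ) : ℝ) = M₁ - 1 := by
          rw [Nat.cast_sub (by omega)]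
          simp
        rw [this]; ring
      rw [h1] at this
      exact_mod_cast this
    have := eval_Ptilde_eq u v p j hne μ
    rw [hex μ hμ'] at this
    exact this
  · have : (1 : ℕ) ≤ L - 1 := by omega
    exact_mod_cast this

/-! #### No zero in the ball -/

/-- **§II-3-4, conclusion, for Théorème 2: the `Q_{μj}`, `|μ| < M₁`, have no common zero in `𝓑_ρ`.**
Given the zero lemma at `n` (constant `c`), `ℚ`-linearly independent `u, v` with (HT2)(a), (b)
(exponents as in `eventually_C9`) and `mn > m + n`, for all large `X`: for every `θ̃` with
`max|θ̃ᵢ - θᵢ| ≤ e^{-ρ}`, every family of unknowns `p` (parameters `D = 1`, `L` at `X`, any `M`) and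
every minimal index `j` at `θ̃`, some `Q_{μj}(θ̃)`, `|μ| < M₁`, is non-zero.
[cite: Diaz1989, §II-3-4 pp. 12–14] -/
theorem eventually_zeroFree (hn : 1 ≤ n) (hmn : m + n < m * n) {c : ℝ} (hc : 0 < c)
    (hZc : ZeroLemmaAt n hn c) {u : Fin n → ℂ} {v : Fin m → ℂ} (hu : LinearIndependent ℚ u)
    (hv : LinearIndependent ℚ v) {ηa ηb : ℝ}
    (hA : Diaz1989.MeasureA u ηa) (hB : Diaz1989.MeasureB v ηb)
    (hηa : 0 ≤ ηa) (hηa' : (2 * (m : ℝ) + n) * ηa ≤ m * n)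
    (hηb : 0 ≤ ηb) (hηb' : ((m : ℝ) + 2 * n) * ηb ≤ m * n) :
    ∀ᶠ X in atTop, ∀ (M : ℕ) (p : Unk m n 1 (Lq m n X) M → ℤ) (θ' : Var m n → ℂ),
      (∀ i, ‖theta u v i - θ' i‖ ≤ Real.exp (-rhoq m n X)) →
      ∀ j : Var m n →₀ ℕ, IsMinIdx p θ' j →
        ∃ μ : Fin m → ℕ, (∀ k, μ k < M1q m n X) ∧ aeval θ' (Qj p μ j) ≠ 0 := by
  have hm : 2 ≤ m := by
    rcases Nat.lt_or_ge m 2 with h | h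
    · have : m * n ≤ 1 * n := Nat.mul_le_mul_right n (by omega)
      omega
    · exact h
  have hm1 : 1 ≤ m := by omega
  have hΔ := Delta0_pos u v
  have hρ4 : ∀ᶠ X in atTop,
      4 * ((∑ h, ∑ k, ‖Complex.exp (-(u h * v k))‖) + m + 1) ≤ rhoq m n X := by
    have h := eventually_const_le_scale (a := (m : ℝ) * n) (b := 1) (Or.inl (by
      have : (1 : ℝ) ≤ m := by exact_mod_cast hm1
      have : (1 : ℝ) ≤ n := by exact_mod_cast hn
      positivity)) (4 * ((∑ h, ∑ k, ‖Complex.exp (-(u h * v k))‖) + m + 1))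
    filter_upwards [h, eventually_ge_atTop (1 : ℝ)] with X hX hX1
    have hs := scale_nonneg (a := (m : ℝ) * n) (b := 1) hX1
    have hn0 : (0 : ℝ) ≤ n := Nat.cast_nonneg n
    calc _ ≤ scale (m * n) 1 X := hX
      _ ≤ 16 * (n + 1) * scale (m * n) 1 X := by nlinarith
      _ = rhoq m n X := rfl
  filter_upwards [hρ4, eventually_L_ge (m := m) (n := n) hm1, eventually_M_ge (n := n) hn,
    eventually_C7 (m := m) (n := n) hm1 hn, eventually_C8 (m := m) hn hmn,
    eventually_C9 hmn hA hB hηa hηa' hηb hηb' hc hΔ, eventually_gt_atTop (0 : ℝ)]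
    with X hρ hL hM h7 h8 h9 hX0 M p θ' hθ' j hj
  obtain ⟨hne, h10a, h10b, h10c, h10d, h10e⟩ := ball_hyps hn u v hρ hθ'
  have hρpos : 0 < rhoq m n X / 2 := by
    have hE : 0 ≤ ∑ h, ∑ k, ‖Complex.exp (-(u h * v k))‖ :=
      Finset.sum_nonneg fun h _ => Finset.sum_nonneg fun k _ => norm_nonneg _
    have hm0 : (0 : ℝ) ≤ m := Nat.cast_nonneg m
    linarith
  have hM₁ : 2 ≤ M1q m n X := by
    unfold M1q
    calc 2 ≤ 1 * 2 := by norm_num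
      _ ≤ a2 m n * Mq n X := Nat.mul_le_mul one_le_a2 hM.2
  rcases exists_aeval_Qj_ne_zero_or hn hm hZc u v hu hv p hj hne hρpos hΔ h10a h10b h10c h10d
      h10e hL.2 hM₁ h7 h8 with h | ⟨lam, mu, hlam, hmu, hl, hμ, hprod⟩
  · exact h
  · exact absurd hprod (not_le.mpr (h9 lam mu hlam hmu hl hμ))

/-! ### §3. The assembly -/

/-! #### Scales: the domination `K Φ^{k+1} ≤ Ψ` -/

/-- `Φ` is non-decreasing on `[1, ∞)`. [folklore] -/
theorem Phq_mono {X Y : ℝ} (hX : 1 ≤ X) (hXY : X ≤ Y) : Phq m n X ≤ Phq m n Y :=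
  scale_mono (by positivity) le_rfl hX hXY

/-- `Ψ` is non-decreasing on `[1, ∞)`. [folklore] -/
theorem Psq_mono {X Y : ℝ} (hX : 1 ≤ X) (hXY : X ≤ Y) : Psq m n X ≤ Psq m n Y :=
  scale_mono (by positivity) zero_le_one hX hXY

/-- **The domination `K Φ^{k+1} ≤ Ψ` eventually**, for `(m+n)(k+1) ≤ mn`: either the powers of `X`
satisfy `(m+n)(k+1) < mn`, or they are equal and the factor `log X` of `Ψ` decides (this is where
`t ≥ [mn/(m+n)]`, and not only `t > mn/(m+n) - 1`, is reached).
[cite: Diaz1989, Théorème 2 p. 2; cf. §II-4-3 p. 16] -/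
theorem eventually_Phq_pow_le_Psq {k : ℕ} (hk : (m + n) * (k + 1) ≤ m * n) (K : ℝ) :
    ∀ᶠ X in atTop, K * Phq m n X ^ (k + 1) ≤ Psq m n X := by
  have hk' : ((m : ℝ) + n) * ((k : ℝ) + 1) ≤ (m : ℝ) * n := by exact_mod_cast hk
  filter_upwards [eventually_mul_scale_zero_le hk' K, eventually_ge_atTop (1 : ℝ)] with X hX hX1
  rw [Phq, scale_pow hX1, Psq]
  push_cast
  simpa only [zero_mul] using hX

/-! #### Siegel's coefficients and the family of polynomials at `X` -/

section Family

variable (u : Fin n → ℂ) (v : Fin m → ℂ)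

open Classical in
/-- The unknowns `p` of Siegel's step at `X` (`D = 1`; `DiazThm1.exists_coeffs`: not all zero,
`|p| ≤ H`, `Q_μ = 0` for `|μ| < M`), when they exist; `0` otherwise. [cite: Diaz1989, §II-2 p. 5] -/
def coeffs (m n : ℕ) (X : ℝ) : Unk m n 1 (Lq m n X) (Mq n X) → ℤ :=
  if h : ∃ p : Unk m n 1 (Lq m n X) (Mq n X) → ℤ, p ≠ 0 ∧
      (∀ w, |(p w : ℝ)| ≤ Hq m n X) ∧ ∀ μ : Fin m → ℕ, (∀ k, μ k < Mq n X) → Q p μ = 0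
  then h.choose else 0

/-- Under (𝒞1) the unknowns exist, so `coeffs` has the three properties of Siegel's step.
[cite: Diaz1989, §II-2 p. 5] -/
theorem coeffs_spec (hm : 1 ≤ m) {X : ℝ} (hL : 1 ≤ Lq m n X) (hM : 1 ≤ Mq n X)
    (hC1 : 2 ^ (m + n * m + 1) * Mq n X ^ m ≤ 1 * Lq m n X ^ n) :
    coeffs m n X ≠ 0 ∧ (∀ w, |(coeffs m n X w : ℝ)| ≤ Hq m n X) ∧
      ∀ μ : Fin m → ℕ, (∀ k, μ k < Mq n X) → Q (coeffs m n X) μ = 0 := by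
  classical
  have h : ∃ p : Unk m n 1 (Lq m n X) (Mq n X) → ℤ, p ≠ 0 ∧
      (∀ w, |(p w : ℝ)| ≤ Hq m n X) ∧ ∀ μ : Fin m → ℕ, (∀ k, μ k < Mq n X) → Q p μ = 0 := by
    obtain ⟨p, hp0, hpb, hpv⟩ := exists_coeffs (n := n) hm le_rfl hL hM hC1
    exact ⟨p, hp0, hpb, hpv⟩
  rw [coeffs, dif_pos h]
  exact h.choose_spec

/-- The ball `𝓑_ρ`: `max |θ̃ᵢ - θᵢ| ≤ e^{-ρ}`. [cite: Diaz1989, §II-3-2 p. 7] -/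
def InBall (X : ℝ) (θ' : Var m n → ℂ) : Prop :=
  ∀ i, ‖theta u v i - θ' i‖ ≤ Real.exp (-rhoq m n X)

/-- `θ ∈ 𝓑_ρ`. [folklore] -/
theorem inBall_theta (X : ℝ) : InBall u v X (theta u v) := fun i => by
  simp [le_of_lt (Real.exp_pos _)]

/-- The good indices at `X`: minimal indices (for `coeffs`) at points of the ball `𝓑_ρ`.
[cite: Diaz1989, §II-3-1 p. 6 (j(θ̃))] -/
def GoodIdx (X : ℝ) (j : Var m n →₀ ℕ) : Prop :=
  ∃ θ' : Var m n → ℂ, InBall u v X θ' ∧ IsMinIdx (coeffs m n X) θ' j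

open Classical in
/-- A minimal index at `θ` itself (when `coeffs ≠ 0`), else `0`. [cite: Diaz1989, §II-3-1 p. 6] -/
def j0 (X : ℝ) : Var m n →₀ ℕ :=
  if h : ∃ j, IsMinIdx (coeffs m n X) (theta u v) j then h.choose else 0

/-- `j0` is a minimal index at `θ` as soon as `coeffs ≠ 0`. [folklore] -/
theorem isMinIdx_j0 {X : ℝ} (h : coeffs m n X ≠ 0) : IsMinIdx (coeffs m n X) (theta u v) (j0 u v X) := by
  classical
  have hex : ∃ j, IsMinIdx (coeffs m n X) (theta u v) j := exists_isMinIdx h _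
  rw [j0, dif_pos hex]
  exact hex.choose_spec

/-- The degree bound `T₀` at `X`. [cite: Diaz1989, §II-3-2 (2) p. 8] -/
abbrev TX (m n : ℕ) (X : ℝ) : ℕ := T0 m n 1 (Lq m n X) (Mq n X)

/-- The index type of the family at `X`: `μ ∈ ℕ^m(M₁)` and a candidate multi-index with entries
`≤ T₀`. [folklore] -/
abbrev FamIdx (m n : ℕ) (X : ℝ) : Type :=
  (Fin m → Fin (M1q m n X)) × (Var m n → Fin (TX m n X + 1))

/-- The multi-index encoded by the second component of a `FamIdx`. [folklore] -/
def toJ {X : ℝ} (e : Var m n → Fin (TX m n X + 1)) : Var m n →₀ ℕ :=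
  Finsupp.equivFunOnFinite.symm fun x => (e x : ℕ)

/-- `toJ e x = e x`. [folklore] -/
@[simp] theorem toJ_apply {X : ℝ} (e : Var m n → Fin (TX m n X + 1)) (x : Var m n) :
    toJ e x = (e x : ℕ) := rfl

open Classical in
/-- The multi-index used for the index `e`: `toJ e` if it is good, else `j0`. [folklore] -/
def jOf (X : ℝ) (e : Var m n → Fin (TX m n X + 1)) : Var m n →₀ ℕ :=
  if GoodIdx u v X (toJ e) then toJ e else j0 u v X

/-- **The family `𝓕_X = {Q_{μj} ; |μ| < M₁, j a minimal index at a point of 𝓑_ρ}`** fed to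
Philippon's criterion, indexed by `FamIdx`. [cite: Diaz1989, §II-4-3 p. 16] -/
def famPoly (X : ℝ) (i : FamIdx m n X) : MvPolynomial (Var m n) ℤ :=
  Qj (coeffs m n X) (fun k => (i.1 k : ℕ)) (jOf u v X i.2)

/-- The `μ` of an index has `|μ| < M₁`. [folklore] -/
theorem mu_lt {X : ℝ} (i : FamIdx m n X) (k : Fin m) : (fun k => (i.1 k : ℕ)) k < M1q m n X :=
  (i.1 k).isLt

/-- If `coeffs ≠ 0`, the multi-index of every member of the family is good. [folklore] -/
theorem goodIdx_jOf {X : ℝ} (h : coeffs m n X ≠ 0) (e : Var m n → Fin (TX m n X + 1)) :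
    GoodIdx u v X (jOf u v X e) := by
  classical
  unfold jOf
  split_ifs with hg
  · exact hg
  · exact ⟨theta u v, inBall_theta u v X, isMinIdx_j0 u v h⟩

/-- A minimal index has all its entries `≤ T₀`. [folklore] -/
theorem le_TX_of_isMinIdx {X : ℝ} {p : Unk m n 1 (Lq m n X) (Mq n X) → ℤ}
    {θ' : Var m n → ℂ} {j : Var m n →₀ ℕ} (hj : IsMinIdx p θ' j) (x : Var m n) :
    j x ≤ TX m n X := by
  classical
  obtain ⟨⟨a, ha⟩, -⟩ := hj
  have hne : Pj p a j ≠ 0 := by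
    intro h0; apply ha; rw [h0, map_zero]
  have hdeg : Finsupp.degree j ≤ (Pdl p a).totalDegree := by
    by_contra hlt
    exact hne (taylorCoeff_eq_zero_of_lt j (Pdl p a) (not_le.mp hlt))
  exact (Finsupp.le_degree x j).trans (hdeg.trans (totalDegree_Pdl_le p a))

/-- Every good index is the multi-index of some member of the family. [folklore] -/
theorem exists_jOf_eq {X : ℝ} {j : Var m n →₀ ℕ} (hj : GoodIdx u v X j) :
    ∃ e : Var m n → Fin (TX m n X + 1), jOf u v X e = j := by
  classical
  obtain ⟨θ', hθ', hmin⟩ := hj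
  refine ⟨fun x => ⟨j x, Nat.lt_succ_of_le (le_TX_of_isMinIdx hmin x)⟩, ?_⟩
  have he : toJ (X := X) (fun x => ⟨j x, Nat.lt_succ_of_le (le_TX_of_isMinIdx hmin x)⟩) = j := by
    ext x; rfl
  rw [jOf, he, if_pos ⟨θ', hθ', hmin⟩]

end Family

/-! #### The eventual facts at `X`, bundled, and the properties of the family -/

section GoodX

variable {m' : ℕ} (u : Fin n → ℂ) (v : Fin (m' + 1) → ℂ)

/-- The facts, valid for all large `X`, that the assembly uses at the level `X` (`m = m'+1`):
`X ≥ 3`; `L, M ≥ 2` and (𝒞1) (Siegel's step applies); the smallness `|Q_{μj}(θ)| ≤ e^{-c_SΨ}`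
(`eventually_small`); the degree and length bounds (`eventually_deg_len`); no common zero in the
ball (`eventually_zeroFree`); and `c_SΨ ≥ 1`. [folklore] -/
structure GoodX (X : ℝ) : Prop where
  three_le : 3 ≤ X
  two_le_L : 2 ≤ Lq (m' + 1) n X
  two_le_M : 2 ≤ Mq n X
  C1 : 2 ^ ((m' + 1) + n * (m' + 1) + 1) * Mq n X ^ (m' + 1) ≤ 1 * Lq (m' + 1) n X ^ n
  small : ∀ (p : Unk (m' + 1) n 1 (Lq (m' + 1) n X) (Mq n X) → ℤ),
      (∀ w, |(p w : ℝ)| ≤ Hq (m' + 1) n X) →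
      (∀ μ' : Fin (m' + 1) → ℕ, (∀ k, μ' k < Mq n X) → Q p μ' = 0) →
      ∀ θ' : Var (m' + 1) n → ℂ, (∀ i, ‖theta u v i - θ' i‖ ≤ Real.exp (-rhoq (m' + 1) n X)) →
      ∀ j : Var (m' + 1) n →₀ ℕ, IsMinIdx p θ' j →
      ∀ μ : Fin (m' + 1) → ℕ, (∀ k, μ k < M1q (m' + 1) n X) →
        ‖MvPolynomial.aeval (theta u v) (Qj p μ j)‖ ≤
          Real.exp (-(cSq (m' + 1) n * Psq (m' + 1) n X))
  degLen : ∀ (p : Unk (m' + 1) n 1 (Lq (m' + 1) n X) (Mq n X) → ℤ),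
      (∀ w, |(p w : ℝ)| ≤ Hq (m' + 1) n X) → ∀ μ : Fin (m' + 1) → ℕ,
      (∀ k, μ k < M1q (m' + 1) n X) → ∀ j : Var (m' + 1) n →₀ ℕ,
        ((Qj p μ j).totalDegree : ℝ) ≤ cdq (m' + 1) n * Phq (m' + 1) n X ∧
        Real.log (l1 (Qj p μ j)) ≤ cdq (m' + 1) n * Phq (m' + 1) n X
  zeroFree : ∀ (M : ℕ) (p : Unk (m' + 1) n 1 (Lq (m' + 1) n X) M → ℤ)
      (θ' : Var (m' + 1) n → ℂ), (∀ i, ‖theta u v i - θ' i‖ ≤ Real.exp (-rhoq (m' + 1) n X)) →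
      ∀ j : Var (m' + 1) n →₀ ℕ, IsMinIdx p θ' j →
        ∃ μ : Fin (m' + 1) → ℕ, (∀ k, μ k < M1q (m' + 1) n X) ∧ aeval θ' (Qj p μ j) ≠ 0
  S_ge : 1 ≤ cSq (m' + 1) n * Psq (m' + 1) n X

/-- **All large `X` are good.** [cite: Diaz1989, §II-4-2 p. 15] -/
theorem eventually_goodX (hm' : 1 ≤ m') (hn : 1 ≤ n) (hmn : (m' + 1) + n < (m' + 1) * n)
    {c : ℝ} (hc : 0 < c)
    (hZc : ZeroLemmaAt n hn c) (hu : LinearIndependent ℚ u) (hv : LinearIndependent ℚ v)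
    {ηa ηb : ℝ} (hA : Diaz1989.MeasureA u ηa) (hB : Diaz1989.MeasureB v ηb)
    (hηa : 0 ≤ ηa) (hηa' : (2 * ((m' + 1 : ℕ) : ℝ) + n) * ηa ≤ (m' + 1 : ℕ) * n)
    (hηb : 0 ≤ ηb) (hηb' : (((m' + 1 : ℕ) : ℝ) + 2 * n) * ηb ≤ (m' + 1 : ℕ) * n) :
    ∀ᶠ X in atTop, GoodX u v X := by
  have hm : 1 ≤ m' + 1 := by omega
  have hS : ∀ᶠ X in atTop, 1 ≤ cSq (m' + 1) n * Psq (m' + 1) n X := by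
    have hcS := cSq_pos (m := m' + 1) (n := n) hmn
    filter_upwards [eventually_const_le_scale (a := ((m' + 1 : ℕ) : ℝ) * n) (b := 1)
      (Or.inl (by
        have : (1 : ℝ) ≤ n := by exact_mod_cast hn
        positivity)) (1 / cSq (m' + 1) n)] with X hX
    rw [Psq]
    have := mul_le_mul_of_nonneg_left hX hcS.le
    rw [mul_one_div_cancel hcS.ne'] at this
    push_cast at this ⊢
    exact this
  filter_upwards [eventually_ge_atTop (3 : ℝ), eventually_L_ge (m := m' + 1) (n := n) hm,
    eventually_M_ge (n := n) hn, eventually_C1 (m := m' + 1) (n := n) hm hn,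
    eventually_small hm' hn hmn u v hB, eventually_deg_len (m := m' + 1) (n := n) hm hn,
    eventually_zeroFree hn hmn hc hZc hu hv hA hB hηa hηa' hηb hηb', hS]
    with X h3 hL hM hC1 hsm hdl hzf hS1
  exact ⟨h3, hL.2, hM.2, hC1, hsm, hdl, hzf, hS1⟩

variable {u v}

/-- At a good `X`, Siegel's coefficients are non-trivial, bounded by `H`, and kill the `Q_μ`,
`|μ| < M`. [cite: Diaz1989, §II-2 p. 5] -/
theorem GoodX.coeffs {X : ℝ} (hG : GoodX u v X) :
    coeffs (m' + 1) n X ≠ 0 ∧ (∀ w, |(coeffs (m' + 1) n X w : ℝ)| ≤ Hq (m' + 1) n X) ∧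
      ∀ μ : Fin (m' + 1) → ℕ, (∀ k, μ k < Mq n X) → Q (coeffs (m' + 1) n X) μ = 0 :=
  coeffs_spec (by omega) (le_trans (by norm_num) hG.two_le_L) (le_trans (by norm_num) hG.two_le_M)
    hG.C1

/-- **All members of the family are small at `θ`**: `|Q(θ)| ≤ exp(-c_S Ψ)`. [cite: Diaz1989, §II-4-2 (c) p. 15] -/
theorem GoodX.small_famPoly {X : ℝ} (hG : GoodX u v X) (i : FamIdx (m' + 1) n X) :
    ‖aeval (theta u v) (famPoly u v X i)‖ ≤ Real.exp (-(cSq (m' + 1) n * Psq (m' + 1) n X)) := by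
  obtain ⟨h0, hb, hv0⟩ := hG.coeffs
  obtain ⟨θ', hθ', hmin⟩ := goodIdx_jOf u v h0 i.2
  exact hG.small _ hb hv0 θ' hθ' _ hmin _ (mu_lt i)

/-- Degrees and lengths of the members of the family: `deg Q ≤ c_δ Φ`, `log L(Q) ≤ c_δ Φ`.
[cite: Diaz1989, §II-4-2 (b) p. 15] -/
theorem GoodX.degLen_famPoly {X : ℝ} (hG : GoodX u v X) (i : FamIdx (m' + 1) n X) :
    ((famPoly u v X i).totalDegree : ℝ) ≤ cdq (m' + 1) n * Phq (m' + 1) n X ∧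
      Real.log (l1 (famPoly u v X i)) ≤ cdq (m' + 1) n * Phq (m' + 1) n X := by
  obtain ⟨-, hb, -⟩ := hG.coeffs
  exact hG.degLen _ hb _ (mu_lt i) _

/-- **No common zero of the family in the ball `𝓑_ρ`.** [cite: Diaz1989, §II-3-4 p. 14] -/
theorem GoodX.exists_ne_zero {X : ℝ} (hG : GoodX u v X) {θ' : Var (m' + 1) n → ℂ}
    (hθ' : InBall u v X θ') : ∃ i : FamIdx (m' + 1) n X, aeval θ' (famPoly u v X i) ≠ 0 := by
  obtain ⟨h0, -, -⟩ := hG.coeffs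
  obtain ⟨j, hj⟩ := exists_isMinIdx h0 θ'
  obtain ⟨μ, hμ, hne⟩ := hG.zeroFree _ _ θ' hθ' j hj
  obtain ⟨e, he⟩ := exists_jOf_eq u v ⟨θ', hθ', hj⟩
  refine ⟨(fun k => ⟨μ k, hμ k⟩, e), ?_⟩
  simpa [famPoly, he] using hne

/-- Some member of the family does not vanish at `θ`. [cite: Diaz1989, §II-4-3 p. 16] -/
theorem GoodX.exists_ne_zero_theta {X : ℝ} (hG : GoodX u v X) :
    ∃ i : FamIdx (m' + 1) n X, aeval (theta u v) (famPoly u v X i) ≠ 0 :=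
  hG.exists_ne_zero (inBall_theta u v X)

/-- **The values of the family do not see the `Y_k`-coordinates** (`D = 1`). [folklore] -/
theorem aeval_famPoly_congr {X : ℝ} {θ₁ θ₂ : Var (m' + 1) n → ℂ}
    (h : ∀ q, θ₁ (Sum.inr q) = θ₂ (Sum.inr q)) (i : FamIdx (m' + 1) n X) :
    aeval θ₁ (famPoly u v X i) = aeval θ₂ (famPoly u v X i) :=
  aeval_Qj_congr _ h _ _

end GoodX

/-! #### The functions `σ = δ`, `R`, `S` of the criterion -/

/-- `σ(N) = δ(N) = c_δ Φ(N + N₁)` (degrees and logarithmic lengths). [cite: Diaz1989, §II-4-3 p. 16] -/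
def sigF (m n N₁ : ℕ) (N : ℕ) : ℝ := cdq m n * Phq m n ((N : ℝ) + N₁)

/-- `R(N) = ρ(N + N₁)` (radius `e^{-R}` of the ball). [cite: Diaz1989, §II-4-3 p. 16] -/
def RF (m n N₁ : ℕ) (N : ℕ) : ℝ := rhoq m n ((N : ℝ) + N₁)

/-- `S(N) = c_S Ψ(N + N₁)` (smallness). [cite: Diaz1989, §II-4-3 p. 16] -/
def SF (m n N₁ : ℕ) (N : ℕ) : ℝ := cSq m n * Psq m n ((N : ℝ) + N₁)

section Growth

variable {N₁ : ℕ} (hN₁ : 3 ≤ N₁)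
include hN₁

/-- `σ` is non-decreasing. [folklore] -/
theorem sigF_mono : Monotone (sigF m n N₁) := by
  intro a b hab
  unfold sigF
  refine mul_le_mul_of_nonneg_left (Phq_mono (by linarith [three_le_X hN₁ a])
    (by simpa using (Nat.cast_le (α := ℝ)).mpr hab)) (le_trans zero_le_one one_le_cdq)

/-- `R` is non-decreasing. [folklore] -/
theorem RF_mono : Monotone (RF m n N₁) := by
  intro a b hab
  unfold RF rhoq
  have hn : (0 : ℝ) ≤ 16 * (n + 1) := by positivity
  exact mul_le_mul_of_nonneg_left (Psq_mono (m := m) (n := n) (by linarith [three_le_X hN₁ a])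
    (by simpa using (Nat.cast_le (α := ℝ)).mpr hab)) hn

/-- `S` is non-decreasing. [folklore] -/
theorem SF_mono : Monotone (SF m n N₁) := by
  intro a b hab
  unfold SF
  exact mul_le_mul_of_nonneg_left (Psq_mono (by linarith [three_le_X hN₁ a])
    (by simpa using (Nat.cast_le (α := ℝ)).mpr hab)) cSq_nonneg_le.1

/-- `σ ≥ X_N ≥ 1` (`m + n ≥ 1`). [folklore] -/
theorem X_le_sigF (hmn : 1 ≤ m + n) (N : ℕ) : (N : ℝ) + N₁ ≤ sigF m n N₁ N := by
  unfold sigF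
  have hX := three_le_X hN₁ N
  have h1 := X_le_Phq (m := m) (n := n) hmn (show (1 : ℝ) ≤ (N : ℝ) + N₁ by linarith)
  have h2 : 0 ≤ Phq m n ((N : ℝ) + N₁) := by linarith
  calc (N : ℝ) + N₁ ≤ Phq m n ((N : ℝ) + N₁) := h1
    _ = 1 * Phq m n ((N : ℝ) + N₁) := (one_mul _).symm
    _ ≤ _ := mul_le_mul_of_nonneg_right one_le_cdq h2

/-- `σ ≥ 1`. [folklore] -/
theorem one_le_sigF (hmn : 1 ≤ m + n) (N : ℕ) : 1 ≤ sigF m n N₁ N :=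
  le_trans (by linarith [three_le_X hN₁ N]) (X_le_sigF hN₁ hmn N)

/-- `R ≥ 1`. [folklore] -/
theorem one_le_RF (N : ℕ) : 1 ≤ RF m n N₁ N := by
  unfold RF rhoq
  have hXe : Real.exp 1 ≤ (N : ℝ) + N₁ := exp_one_le_X hN₁ N
  have hmn' : (0 : ℝ) ≤ (m : ℝ) * n := by positivity
  have h1 : 1 ≤ scale (m * n) 1 ((N : ℝ) + N₁) := one_le_scale hmn' zero_le_one hXe
  have hn : (0 : ℝ) ≤ n := Nat.cast_nonneg n
  nlinarith

/-- `σ + δ → ∞`. [folklore] -/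
theorem tendsto_sigF (hmn : 1 ≤ m + n) : Tendsto (fun N => sigF m n N₁ N + sigF m n N₁ N) atTop atTop := by
  refine tendsto_atTop_mono (fun N => ?_) tendsto_natCast_atTop_atTop
  have h1 := X_le_sigF (m := m) (n := n) hN₁ hmn N
  have h2 : (0 : ℝ) ≤ N₁ := Nat.cast_nonneg N₁
  linarith

/-- **The quotient `S/((σ+δ)δ^k)` is a scale**, with nonnegative exponents when
`(m+n)(k+1) ≤ mn`, hence non-decreasing. [folklore] -/
theorem ratio_eq {k : ℕ} (N : ℕ) :
    SF m n N₁ N / ((sigF m n N₁ N + sigF m n N₁ N) * sigF m n N₁ N ^ k) =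
      cSq m n / (2 * cdq m n ^ (k + 1)) *
        scale ((m : ℝ) * n - ((m : ℝ) + n) * ((k : ℝ) + 1)) (1 - 0 * ((k : ℝ) + 1)) ((N : ℝ) + N₁) := by
  set X : ℝ := (N : ℝ) + N₁ with hXdef
  have hX1 : 1 < X := by linarith [three_le_X hN₁ N]
  have hcd : (0 : ℝ) < cdq m n := lt_of_lt_of_le one_pos one_le_cdq
  have hΦ : 0 < Phq m n X := scale_pos hX1
  unfold SF sigF
  rw [← hXdef]
  have e1 : (cdq m n * Phq m n X + cdq m n * Phq m n X) * (cdq m n * Phq m n X) ^ k =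
      2 * cdq m n ^ (k + 1) * Phq m n X ^ (k + 1) := by ring
  rw [e1, Phq, scale_pow hX1.le, Psq]
  have hs : 0 < scale (((m : ℝ) + n) * ((k + 1 : ℕ) : ℝ)) (0 * ((k + 1 : ℕ) : ℝ)) X :=
    scale_pos hX1
  rw [← scale_div_scale hX1]
  push_cast
  field_simp

/-- The quotient `S/((σ+δ)δ^k)` is non-decreasing when `(m+n)(k+1) ≤ mn`. [folklore] -/
theorem ratio_mono {k : ℕ} (hk : (m + n) * (k + 1) ≤ m * n) :
    Monotone fun N => SF m n N₁ N / ((sigF m n N₁ N + sigF m n N₁ N) * sigF m n N₁ N ^ k) := by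
  intro a b hab
  simp only [ratio_eq hN₁]
  have hcd : (0 : ℝ) < cdq m n := lt_of_lt_of_le one_pos one_le_cdq
  have hK : 0 ≤ cSq m n / (2 * cdq m n ^ (k + 1)) := div_nonneg cSq_nonneg_le.1 (by positivity)
  refine mul_le_mul_of_nonneg_left (scale_mono ?_ ?_ (by linarith [three_le_X hN₁ a])
    (by simpa using (Nat.cast_le (α := ℝ)).mpr hab)) hK
  · have : ((m : ℝ) + n) * ((k : ℝ) + 1) ≤ (m : ℝ) * n := by exact_mod_cast hk
    linarith
  · simp

end Growth

/-! #### The main inequality `S^{k+2} ≥ C(σ+δ)δ^k(S^{k+1} + R^{k+1})` of the criterion -/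

/-- The constant `K` with `C(σ+δ)(N+1)δ(N+1)^k(S(N)^{k+1} + R(N+1)^{k+1}) ≤ K Φ^{k+1}Ψ^{k+1}`
(at `X = N + N₁`). [folklore] -/
def Kmain (m n k : ℕ) (C : ℝ) : ℝ :=
  2 * C * cdq m n ^ (k + 1) * ((2 : ℝ) ^ (((m : ℝ) + n) + 0)) ^ (k + 1) *
    (cSq m n ^ (k + 1) + (16 * ((n : ℝ) + 1) * (2 : ℝ) ^ ((m : ℝ) * n + 1)) ^ (k + 1))

/-- **The main inequality of the criterion at `X`**, from the domination
`K Φ(X)^{k+1} ≤ c_S^{k+2} Ψ(X)` (the values at `X + 1` are at most `2^{a+b}` times those at `X`).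
[cite: Diaz1989, §II-4-3 p. 16] -/
theorem main_ineq_at {k : ℕ} {C X : ℝ} (hC : 1 ≤ C) (hX : 2 ≤ X)
    (hE : Kmain m n k C * Phq m n X ^ (k + 1) ≤ cSq m n ^ (k + 2) * Psq m n X) :
    C * (cdq m n * Phq m n (X + 1) + cdq m n * Phq m n (X + 1)) *
        (cdq m n * Phq m n (X + 1)) ^ k *
        ((cSq m n * Psq m n X) ^ (k + 1) + rhoq m n (X + 1) ^ (k + 1)) ≤
      (cSq m n * Psq m n X) ^ (k + 2) := by
  have hX1 : 1 ≤ X := by linarith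
  have hn0 : (0 : ℝ) ≤ n := Nat.cast_nonneg n
  set g : ℝ := (2 : ℝ) ^ (((m : ℝ) + n) + 0) with hg
  set g' : ℝ := (2 : ℝ) ^ ((m : ℝ) * n + 1) with hg'
  have hΦ0 : 0 ≤ Phq m n X := scale_nonneg hX1
  have hΨ0 : 0 ≤ Psq m n X := scale_nonneg hX1
  have hΦ1 : Phq m n (X + 1) ≤ g * Phq m n X :=
    scale_add_one_le (by positivity) le_rfl hX
  have hΨ1 : Psq m n (X + 1) ≤ g' * Psq m n X := scale_add_one_le (by positivity) zero_le_one hX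
  have hΦ10 : 0 ≤ Phq m n (X + 1) := scale_nonneg (by linarith)
  have hΨ10 : 0 ≤ Psq m n (X + 1) := scale_nonneg (by linarith)
  have hcd : 0 ≤ cdq m n := le_trans zero_le_one one_le_cdq
  have hcS : 0 ≤ cSq m n := cSq_nonneg_le.1
  have hC0 : 0 ≤ C := le_trans zero_le_one hC
  set c16 : ℝ := 16 * ((n : ℝ) + 1) with hc16
  have hc0 : 0 ≤ c16 := by positivity
  have hρ : rhoq m n (X + 1) = c16 * Psq m n (X + 1) := rfl
  calc C * (cdq m n * Phq m n (X + 1) + cdq m n * Phq m n (X + 1)) *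
        (cdq m n * Phq m n (X + 1)) ^ k *
        ((cSq m n * Psq m n X) ^ (k + 1) + rhoq m n (X + 1) ^ (k + 1))
      = 2 * C * cdq m n ^ (k + 1) * (Phq m n (X + 1) ^ (k + 1) *
          ((cSq m n * Psq m n X) ^ (k + 1) + c16 ^ (k + 1) * Psq m n (X + 1) ^ (k + 1))) := by
        rw [hρ, mul_pow c16 (Psq m n (X + 1)) (k + 1), mul_pow (cdq m n) (Phq m n (X + 1)) k]
        ring
    _ ≤ 2 * C * cdq m n ^ (k + 1) * ((g * Phq m n X) ^ (k + 1) *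
          ((cSq m n * Psq m n X) ^ (k + 1) + c16 ^ (k + 1) * (g' * Psq m n X) ^ (k + 1))) := by
        gcongr
    _ = Kmain m n k C * Phq m n X ^ (k + 1) * Psq m n X ^ (k + 1) := by
        rw [Kmain, ← hg, ← hg', ← hc16, mul_pow g, mul_pow g', mul_pow c16, mul_pow (cSq m n)]
        ring
    _ ≤ cSq m n ^ (k + 2) * Psq m n X * Psq m n X ^ (k + 1) :=
        mul_le_mul_of_nonneg_right hE (pow_nonneg hΨ0 _)
    _ = (cSq m n * Psq m n X) ^ (k + 2) := by rw [mul_pow]; ring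

/-! #### Diaz's Théorème 2 from Philippon's criterion and the zero lemma -/

/-- The exponent bookkeeping: with `t = [mn/(m+n)]` (`mn > m + n`) and `k = t - 1` one has
`k + 1 = t` and `(m+n)(k+1) ≤ mn`. [folklore] -/
theorem exponent_facts (hmn : m + n < m * n) :
    m * n / (m + n) - 1 + 1 = m * n / (m + n) ∧ (m + n) * (m * n / (m + n) - 1 + 1) ≤ m * n := by
  have hpos : 0 < m + n := by
    rcases Nat.eq_zero_or_pos (m + n) with h | h
    · have hm : m = 0 := by omega
      subst hm
      simp at hmn
    · exact h
  have ht1 : 1 ≤ m * n / (m + n) := by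
    rw [Nat.le_div_iff_mul_le hpos, one_mul]
    exact hmn.le
  have e : m * n / (m + n) - 1 + 1 = m * n / (m + n) := by omega
  refine ⟨e, ?_⟩
  rw [e, mul_comm]
  exact Nat.div_mul_le_self _ _

/-- Adjoining `0` as well does not change the generated field. [folklore] -/
theorem adjoin_insert_zero_eq (S : Set ℂ) :
    IntermediateField.adjoin ℚ (insert 0 S) = IntermediateField.adjoin ℚ S := by
  refine le_antisymm ?_ (IntermediateField.adjoin.mono _ _ _ (Set.subset_insert _ _))
  refine IntermediateField.adjoin_le_iff.mpr (Set.insert_subset ?_ (IntermediateField.subset_adjoin _ _))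
  exact zero_mem _

end DiazThm2

open DiazThm2 in
open DiazThm1 (Var theta varEquiv exists_zeroLemmaAt l1_rename_of_injective trdeg_adjoin_congr three_le_X) in
/-- **Diaz 1989, Théorème 2, from Philippon's criterion (Thm 2.11) and the zero lemma**: apply the
criterion at `θ'' = (0, …, 0, e^{u_hv_k}) ∈ ℂ^{m+nm}` with `σ = δ ≍ X^{m+n}`, `R = ρ`, `S ≍ X^{mn} log X`
and the ideals `I_N` generated by the `Q_{μj}` of the `D = 1` construction (`|μ| < M₁`, `j` a minimal
index at a point of the ball `𝓑_ρ` around `θ = (v_k, e^{u_hv_k})`): these polynomials do not involve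
the `Y_k`, they are small at `θ` hence at `θ''`, not all zero there, without common zero near `θ''`
(a common zero `z` would give the common zero `(v_k, z_hk) ∈ 𝓑_ρ`), and the growth conditions hold
with `k + 1 = [mn/(m+n)]` because `(m+n)(k+1) ≤ mn` and `Ψ` carries an extra `log X`; finally
`ℚ(θ'') = ℚ(e^{u_hv_k})`. [cite: Diaz1989, Théorème 2, p. 2; proof scheme §II, pp. 4–16] -/
theorem Diaz1989_thm2_of_criterion (hC : Philippon1986_mainCriterion) (hZ : Diaz1989_zeroLemma) :
    Diaz1989_thm2 := by
  intro n m u v hu hv hA hB hmn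
  -- `mn > m + n` forces `m, n ≥ 2`
  have hm2 : 2 ≤ m := by
    rcases Nat.lt_or_ge m 2 with h | h
    · have : m * n ≤ 1 * n := Nat.mul_le_mul_right n (by omega)
      omega
    · exact h
  have hn2 : 2 ≤ n := by
    rcases Nat.lt_or_ge n 2 with h | h
    · have : m * n ≤ m * 1 := Nat.mul_le_mul_left m (by omega)
      omega
    · exact h
  have hn : 1 ≤ n := by omega
  obtain ⟨m', rfl⟩ : ∃ m', m = m' + 1 := ⟨m - 1, by omega⟩
  have hm' : 1 ≤ m' := by omega
  have hm1 : 1 ≤ m' + 1 := by omega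
  obtain ⟨c, hc, hZc⟩ := exists_zeroLemmaAt hZ n hn
  -- Diaz's exponents qualify for (𝒞9) (both with equality)
  have hmc : ((m' + 1 : ℕ) : ℝ) = (m' : ℝ) + 1 := by push_cast; ring
  have hηa : (0 : ℝ) ≤ ((m' + 1 : ℕ) * n : ℝ) / (2 * (m' + 1 : ℕ) + n) := by positivity
  have hηa' : (2 * ((m' + 1 : ℕ) : ℝ) + n) * (((m' + 1 : ℕ) * n : ℝ) / (2 * (m' + 1 : ℕ) + n)) ≤
      (m' + 1 : ℕ) * n := by
    rw [hmc]
    have hd : (0 : ℝ) < 2 * ((m' : ℝ) + 1) + n := by positivity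
    rw [mul_div_cancel₀ _ hd.ne']
  have hηb : (0 : ℝ) ≤ ((m' + 1 : ℕ) * n : ℝ) / ((m' + 1 : ℕ) + 2 * n) := by positivity
  have hηb' : (((m' + 1 : ℕ) : ℝ) + 2 * n) * (((m' + 1 : ℕ) * n : ℝ) / ((m' + 1 : ℕ) + 2 * n)) ≤
      (m' + 1 : ℕ) * n := by
    rw [hmc]
    have hd : (0 : ℝ) < ((m' : ℝ) + 1) + 2 * n := by positivity
    rw [mul_div_cancel₀ _ hd.ne']
  -- the exponent `k + 1 = [mn/(m+n)]`
  obtain ⟨hk1, hk⟩ := exponent_facts (m := m' + 1) (n := n) hmn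
  set k : ℕ := (m' + 1) * n / ((m' + 1) + n) - 1 with hkdef
  -- the transported point `θ'' ∈ ℂ^q`
  set eV := varEquiv (m' + 1) n with heV
  set θ₀ : Var (m' + 1) n → ℂ :=
    Sum.elim (fun _ => (0 : ℂ)) (fun p : Fin n × Fin (m' + 1) => Complex.exp (u p.1 * v p.2)) with hθ₀
  set θq : Fin ((m' + 1) + n * (m' + 1)) → ℂ := θ₀ ∘ eV.symm with hθq
  have hθ₀inr : ∀ q, θ₀ (Sum.inr q) = theta u v (Sum.inr q) := fun q => by
    simp [hθ₀]
  have hkq : k ≤ (m' + 1) + n * (m' + 1) := by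
    have h1 : (m' + 1) * n / ((m' + 1) + n) ≤ (m' + 1) * n := Nat.div_le_self _ _
    have h2 : (m' + 1) * n = n * (m' + 1) := Nat.mul_comm _ _
    omega
  obtain ⟨C, hC1, hcrit⟩ := hC _ k θq hkq
  -- a threshold `X₀` beyond which every `X` is good and the domination of the main inequality holds
  have hcS := cSq_pos (m := m' + 1) (n := n) hmn
  have hev := (eventually_goodX u v hm' hn hmn hc hZc hu hv hA hB hηa hηa' hηb hηb').and
    (eventually_Phq_pow_le_Psq (m := m' + 1) (n := n) hk
      (Kmain (m' + 1) n k C / cSq (m' + 1) n ^ (k + 2)))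
  obtain ⟨X₀, hX₀⟩ := Filter.eventually_atTop.mp hev
  set N₁ : ℕ := ⌈max X₀ 0⌉₊ + 3 with hN₁def
  have hN₁3 : 3 ≤ N₁ := by omega
  have hXN : ∀ N : ℕ, X₀ ≤ (N : ℝ) + N₁ := fun N => by
    have h1 : X₀ ≤ ⌈max X₀ 0⌉₊ := (le_max_left _ _).trans (Nat.le_ceil _)
    have h2 : (N₁ : ℝ) = (⌈max X₀ 0⌉₊ : ℝ) + 3 := by rw [hN₁def]; push_cast; ring
    have h3 : (0 : ℝ) ≤ N := Nat.cast_nonneg N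
    linarith
  have hG : ∀ N : ℕ, GoodX u v ((N : ℝ) + N₁) := fun N => (hX₀ _ (hXN N)).1
  have hE : ∀ N : ℕ, Kmain (m' + 1) n k C * Phq (m' + 1) n ((N : ℝ) + N₁) ^ (k + 1) ≤
      cSq (m' + 1) n ^ (k + 2) * Psq (m' + 1) n ((N : ℝ) + N₁) := fun N => by
    have h := (hX₀ _ (hXN N)).2
    have hpos : 0 < cSq (m' + 1) n ^ (k + 2) := pow_pos hcS _
    have := mul_le_mul_of_nonneg_left h hpos.le
    rwa [← mul_assoc, mul_div_cancel₀ _ hpos.ne'] at this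
  have hmn1 : 1 ≤ (m' + 1) + n := by omega
  -- the criterion
  have main := hcrit (sigF (m' + 1) n N₁) (sigF (m' + 1) n N₁) (RF (m' + 1) n N₁) (SF (m' + 1) n N₁)
    (sigF_mono hN₁3) (sigF_mono hN₁3) (RF_mono hN₁3) (SF_mono hN₁3)
    (one_le_sigF hN₁3 hmn1) (one_le_sigF hN₁3 hmn1) (one_le_RF hN₁3) (fun N => (hG N).S_ge)
    (tendsto_sigF hN₁3 hmn1) (ratio_mono hN₁3 hk)
    (fun N => by
      have h := main_ineq_at (m := m' + 1) (n := n) (k := k) hC1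
        (by linarith [three_le_X hN₁3 N]) (hE N)
      simp only [sigF, RF, SF, Nat.cast_succ]
      convert h using 4 <;> ring_nf)
    0 (fun N => Fintype.card (FamIdx (m' + 1) n ((N : ℝ) + N₁)))
    (fun N i => rename eV (famPoly u v ((N : ℝ) + N₁) ((Fintype.equivFin _).symm i)))
    (fun N _ => by
      have hGN := hG N
      have hθ : θq ∘ eV = θ₀ := by
        funext x; simp [hθq]
      refine ⟨?_, ?_, ?_, ?_, ?_⟩
      · -- no common zero in the ball of radius `e^{-R(N)} = e^{-ρ}` around `θ''`
        refine Set.finite_empty.subset ?_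
        rintro z ⟨hz, hz0⟩
        -- the point `(v_k, z_hk)` lies in the ball `𝓑_ρ` around `θ`
        set z' : Var (m' + 1) n → ℂ := Sum.elim v (fun q => z (eV (Sum.inr q))) with hz'
        have hball : InBall u v ((N : ℝ) + N₁) z' := by
          intro x
          cases x with
          | inl k' => simp [hz', le_of_lt (Real.exp_pos _)]
          | inr q =>
            have := hz (eV (Sum.inr q))
            rw [norm_sub_rev]
            have e1 : θq (eV (Sum.inr q)) = theta u v (Sum.inr q) := by
              simp [hθq, hθ₀]
            simpa [hz', e1, RF] using this
        obtain ⟨i, hi⟩ := hGN.exists_ne_zero hball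
        apply hi
        have := hz0 (Fintype.equivFin _ i)
        rw [aeval_rename, Equiv.symm_apply_apply] at this
        rw [← this]
        exact aeval_famPoly_congr (fun q => by simp [hz']) i
      · intro j
        refine le_trans ?_ (hGN.degLen_famPoly ((Fintype.equivFin _).symm j)).1
        exact_mod_cast totalDegree_rename_le _ _
      · intro j
        rw [l1_rename_of_injective eV.injective]
        exact (hGN.degLen_famPoly ((Fintype.equivFin _).symm j)).2
      · obtain ⟨i, hi⟩ := hGN.exists_ne_zero_theta
        refine ⟨Fintype.equivFin _ i, ?_⟩
        rw [aeval_rename, hθ, Equiv.symm_apply_apply,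
          aeval_famPoly_congr (θ₂ := theta u v) (fun q => hθ₀inr q) i]
        exact hi
      · intro j
        rw [aeval_rename, hθ, aeval_famPoly_congr (θ₂ := theta u v) (fun q => hθ₀inr q)]
        exact hGN.small_famPoly ((Fintype.equivFin _).symm j))
  -- conclusion: `ℚ(θ'') = ℚ(e^{uv})` and `k + 1 = [mn/(m+n)]`
  have hr : Set.range θq = insert 0
      (Set.range fun p : Fin n × Fin (m' + 1) => Complex.exp (u p.1 * v p.2)) := by
    rw [hθq, eV.symm.surjective.range_comp, hθ₀, Set.Sum.elim_range, Set.range_const,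
      Set.singleton_union]
  have hfin : (((((m' + 1) * n) / ((m' + 1) + n) : ℕ)) : Cardinal) ≤
      Algebra.trdeg ℚ ↥(IntermediateField.adjoin ℚ (Set.range θq)) := by
    rw [← hk1]; exact main
  refine hfin.trans_eq ?_
  rw [trdeg_adjoin_congr hr, adjoin_insert_zero_eq]

/-- **Diaz 1989, Théorème 2, from Philippon's two theorems of 1986** (the criterion, Thm 2.11, and
the zero estimate on `𝔾ₐ × 𝔾ₘⁿ`, through `Diaz1989_zeroLemma_of_P1n`).
[cite: Diaz1989, Théorème 2, p. 2] -/
theorem Diaz1989_thm2_of_philippon (hC : Philippon1986_mainCriterion)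
    (hZ : Philippon1986_GaGm_P1n) : Diaz1989_thm2 :=
  Diaz1989_thm2_of_criterion hC (Diaz1989_zeroLemma_of_P1n hZ)

/-- LNM 1752, Ch. 14, Thm 2.7 (bound for `t`, under (T.H.)) from Philippon's criterion and the
zero lemma (through the tree's `Diaz1989_grid_of_thm2`).
[cite: NesterenkoPhilippon2001, Ch. 14 Thm 2.7 (t), p. 248] -/
theorem Diaz1989_grid_of_criterion2 (hC : Philippon1986_mainCriterion) (hZ : Diaz1989_zeroLemma) :
    Diaz1989_grid :=
  Diaz1989_grid_of_thm2 (Diaz1989_thm2_of_criterion hC hZ)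

/-- LNM 1752, Ch. 14, Thm 2.7 (bound for `t`, under (T.H.)) from Philippon's two theorems of 1986.
[cite: NesterenkoPhilippon2001, Ch. 14 Thm 2.7 (t), p. 248] -/
theorem Diaz1989_grid_of_philippon (hC : Philippon1986_mainCriterion) (hZ : Philippon1986_GaGm_P1n) :
    Diaz1989_grid :=
  Diaz1989_grid_of_thm2 (Diaz1989_thm2_of_philippon hC hZ)

end Literature.NumberTheory.Transcendental

end
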